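import Summits.QuantumFields.BalabanUV.Beta.GAN24.Push3LegTelescope

/-!
# `BalabanUV.Beta.GAN24.LayerTransportCells` — binder row G-an2-4 ∕ (CONV-C), W-slot CT-W, route «WC-TL» ∕ «QR-LL», row **(LT-Δ) «LAYER TRANSPORT»**, part (LT-CELLS):
# **THE EIGHT-CELL SOCKET OF THE LAYER BOUND `hLT`** — the OWNER gan24-p1 g28's leg-agnostic END `WardRemainderEndThree.wLocStencil_unitS_three_of_layer` (INTENT
# I-gan24p1-g28-1∕-2 v1.1) displays ONE layer bound `hLT : BiLoc (c • push₃ T T T S ν U) U U (K·θ·ω U) r` for the DRESSED composite legs `T`; with the legs split as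
# `T = U + G` (undressed column + gauge part — the K-LL-4 decomposition of record, `RespStepBmDecompPsi.legAct_legChain_respStepBm`), the cubic push is the sum of the
# EIGHT leg cells `push₃ X Y Z S`, `X, Y, Z ∈ {U, G}`, and `hLT` holds with `K = Σ_cells K_XYZ` as soon as each cell is bi-localised with its own level-free constant

NOT IN PRINT; OUR BOOKKEEPING ([folklore] trilinear expansion BY NAME: this lineage's `Push3LegTelescope.push₃_add_left ∕ _add_right ∕ _add_table` (g58) on the bounded ∕ summable
class ⨾ `KernelWard.biLoc_add` ⨾ `smul_add`; G-an2-4 formalisation swarm, leaf prover `b2b-balaban-gan24-formalise-leaf-01`, gen 65, INTENT I-leaf01-g65-2 + A1).  HONEST FRAMING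
(cell contract, verbatim): «discharging `BetaPertH` makes Bałaban's UV stability UNCONDITIONAL — a real constructive-QFT result; it is NOT the continuum limit and NOT the Clay
problem.»  HONEST DEPENDENCY (verbatim): «continuum YM on T⁴ ⇐ BetaPertH ∧ nine spine estimates (0/9 proved); BetaPertH ⇐ (D1) ∧ (D4) ∧ CAP+tail; G-an2-4 gates asym, D1 and
NE2/3/4.»

## What (generic `d`; GENERIC leg families `U, G` — bounded, with summable fine rows ∕ columns — and a local table `S`; no object of an2's typed system)
§1 **`push₃_add_legs_eq_sum_cells`**: `push₃ (U+G) (U+G) (U+G) S κ′ u′ = Σ` of the eight cells (left leg expanded first, then right, then table).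
§2 **`biLoc_smul_push₃_of_cells`**: eight cell hypotheses `BiLoc (c • push₃ X Y Z S ν U) U U (K_XYZ · W) r` ⟹ `BiLoc (c • push₃ (U+G) (U+G) (U+G) S ν U) U U ((Σ K_XYZ) · W) r`
   — the END's `hLT` shape with `c = (Lc^{k+1})^{3(d+1)}`, `W = θ^{k+1}·e^{−η‖Y−U‖₁}`; **`biLoc_smul_push₃_of_cells'`** — the same for legs `T` with a displayed split `hT : T = U + G`.
§3 **`biLoc_smul_push₃_of_telescope`** (the CT-3 route's form, `Push3LegTelescope.push₃_telescope`): the pure cell `push₃ U U U S` + the THREE one-gauge cells `push₃ (T−U) T T S`,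
   `push₃ U (T−U) T S`, `push₃ U U (T−U) S` ⟹ `BiLoc (c • push₃ T T T S ν U₀) U₀ U₀ ((K₀+K₁+K₂+K₃)·W) r` — three gauge cells instead of seven, at the price of dressed co-legs.
WHERE THE CELLS STAND (located, by name; NOT proved here): (UUU) = the pure cell — `LayerTransportBiLoc.biLoc_cubic_push₃_layer_three_weight` on the UNDRESSED envelopes
(N1)∕(N1′) (leaf-12 `RespStepDecay`) and (N1″)_{1∕2} (leaf-02 `RespStepSecondDiff`), modulo the letter-side rows; cells with a gauge KERNEL leg (`X = G` or `Y = G`) — the (b2)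
mechanism `LayerPushGaugeLeg.tsum_div_eq_zero` ∕ `LayerPushGaugeLeft.abs_push₃_gaugeLeft_le_weighted` (summation by parts onto the letter's kernel index; frozen term zero);
cells with the gauge TABLE leg (`Z = G`) — the (b3) slot-Ward mechanism `LayerPushGaugeTable.slotWard_wilsonA` ∕ `LayerPushGaugeTableCell.abs_push₃_gaugeTable_le_weighted ∕
_sub_dipole_le_weighted ∕ _of_dipoleFree` (absolute count MARGINAL `L^{d−3}`, dipole-free `L^{d−4}` — journal R-gan24p1-g26-2, E17∕E20: «seams ≡ the (S)∕moment item»).  K-LL-4 is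
OPEN; this file only fixes the interface every cell supplier meets: ONE `BiLoc` per cell at the END's centre `U`, rate `r`, with a level-free constant times the common weight `W`.
[folklore]; 0 cited facts, 0 `def`, 0 `def … : Prop`, 0 sorry.  NOTHING of (Q-R)∕(LT)∕(Q-L)∕(C)∕(S)∕«T2Shape»∕«T2Drift»∕(hW, hWall) discharged; NEVER «G-an2-4 closed» as (CONV-C); NOT D1,
NOT `BetaPertH`, NOT continuum, NOT Clay.  2026-08-22; no existing file touched.
-/

noncomputable section

open Finset
open scoped BigOperators
open Literature.MathematicalPhysics.QuantumFieldTheory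
open Literature.MathematicalPhysics.QuantumFieldTheory.Balaban1983to89
open Literature.MathematicalPhysics.QuantumFieldTheory.Balaban1983to89.Beta
open ExpKernelCalculus (MKer Site BiLoc)
open KernelWard (biLoc_add)
open OneStepResolventKernel (Fib LocStencil)
open Summit.QuantumFields.BalabanUV.Beta.GAN24.Push3 (push₃)
open Summit.QuantumFields.BalabanUV.Beta.GAN24.Push3LegTelescope (push₃_add_left push₃_add_right push₃_add_table push₃_telescope)

namespace Summit.QuantumFields.BalabanUV.Beta.GAN24.LayerTransportCells

variable {d : ℕ}
variable {U G : Fin (d + 1) → (Fin (d + 1) → ℤ) → Fin (d + 1) → (Fin (d + 1) → ℤ) → ℝ}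
  {S : Fin (d + 1) → (Fin (d + 1) → ℤ) → MKer (d + 1) (Fib d)} {CU CG Cs δ : ℝ}

/-! ## §1 The cubic push through split legs is the sum of eight cells -/

/-- [folklore] Bounds and slice summability of a sum of two leg families. -/
theorem legs_add_bdd (hU : ∀ α x' κ x, |U α x' κ x| ≤ CU) (hG : ∀ α x' κ x, |G α x' κ x| ≤ CG) :
    ∀ α x' κ x, |(U + G) α x' κ x| ≤ CU + CG := fun α x' κ x => by
  simp only [Pi.add_apply]
  exact (abs_add_le _ _).trans (add_le_add (hU α x' κ x) (hG α x' κ x))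

/-- [folklore] Row summability of a sum of two leg families. -/
theorem legs_add_summable_rows (hUs : ∀ α x' κ, Summable fun x => U α x' κ x) (hGs : ∀ α x' κ, Summable fun x => G α x' κ x) :
    ∀ α x' κ, Summable fun x => (U + G) α x' κ x := fun α x' κ =>
  ((hUs α x' κ).add (hGs α x' κ)).congr fun x => by simp only [Pi.add_apply]

/-- NOT IN PRINT; OUR BOOKKEEPING (`Push3LegTelescope.push₃_add_left ∕ _add_right ∕ _add_table`).  **THE EIGHT CELLS.**  For leg families `U, G` bounded by `CU, CG` with summable
fine rows AND columns (the literal's three legs are one chain, so both are available) and a local table `LocStencil S Cs δ`, `δ > 0`: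
`push₃ (U+G) (U+G) (U+G) S κ′ u′ = push₃ U U U S + push₃ U U G S + push₃ U G U S + push₃ U G G S + push₃ G U U S + push₃ G U G S + push₃ G G U S + push₃ G G G S` (all at `κ′ u′`). -/
theorem push₃_add_legs_eq_sum_cells (hU : ∀ α x' κ x, |U α x' κ x| ≤ CU) (hG : ∀ α x' κ x, |G α x' κ x| ≤ CG)
    (hUr : ∀ α x' κ, Summable fun x => U α x' κ x) (hGr : ∀ α x' κ, Summable fun x => G α x' κ x)
    (hS : LocStencil S Cs δ) (hδ : 0 < δ) (κ' : Fin (d + 1)) (u' : Fin (d + 1) → ℤ) :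
    push₃ (U + G) (U + G) (U + G) S κ' u'
      = push₃ U U U S κ' u' + push₃ U U G S κ' u' + push₃ U G U S κ' u' + push₃ U G G S κ' u'
        + push₃ G U U S κ' u' + push₃ G U G S κ' u' + push₃ G G U S κ' u' + push₃ G G G S κ' u' := by
  have hUG := legs_add_bdd hU hG
  have hUGr := legs_add_summable_rows hUr hGr
  -- left leg
  rw [push₃_add_left hU hUr hG hGr hUGr hUG hS hδ κ' u']
  -- right leg, in both terms
  rw [push₃_add_right hU hUr hGr hUG hS hδ κ' u', push₃_add_right hG hUr hGr hUG hS hδ κ' u']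
  -- table leg, in all four terms
  rw [push₃_add_table hU hUr hUr hU hG hS hδ κ' u', push₃_add_table hU hUr hGr hU hG hS hδ κ' u',
    push₃_add_table hG hGr hUr hU hG hS hδ κ' u', push₃_add_table hG hGr hGr hU hG hS hδ κ' u']
  abel

/-! ## §2 The layer bound from the eight cells -/

/-- NOT IN PRINT; OUR BOOKKEEPING.  **THE EIGHT-CELL SOCKET OF `hLT`.**  If every leg cell `push₃ X Y Z S ν U` (`X, Y, Z ∈ {U, G}`), weighted by the common scalar `c`, is
bi-localised at the output slot `U₀` with rate `r` and constant `K_XYZ · W` (a level-free cell constant times the COMMON weight `W` — in the END: `c = (Lc^{k+1})^{3(d+1)}`,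
`W = θ^{k+1}·e^{−η‖Y−U₀‖₁}`), then the cubic push through the split legs `U + G` is bi-localised there with constant `(Σ_cells K_XYZ) · W`. -/
theorem biLoc_smul_push₃_of_cells (hU : ∀ α x' κ x, |U α x' κ x| ≤ CU) (hG : ∀ α x' κ x, |G α x' κ x| ≤ CG)
    (hUr : ∀ α x' κ, Summable fun x => U α x' κ x) (hGr : ∀ α x' κ, Summable fun x => G α x' κ x)
    (hS : LocStencil S Cs δ) (hδ : 0 < δ) (c : ℝ) (ν : Fin (d + 1)) (U₀ : Fin (d + 1) → ℤ) {r W Kuuu Kuug Kugu Kugg Kguu Kgug Kggu Kggg : ℝ}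
    (huuu : BiLoc (c • push₃ U U U S ν U₀) U₀ U₀ (Kuuu * W) r) (huug : BiLoc (c • push₃ U U G S ν U₀) U₀ U₀ (Kuug * W) r)
    (hugu : BiLoc (c • push₃ U G U S ν U₀) U₀ U₀ (Kugu * W) r) (hugg : BiLoc (c • push₃ U G G S ν U₀) U₀ U₀ (Kugg * W) r)
    (hguu : BiLoc (c • push₃ G U U S ν U₀) U₀ U₀ (Kguu * W) r) (hgug : BiLoc (c • push₃ G U G S ν U₀) U₀ U₀ (Kgug * W) r)
    (hggu : BiLoc (c • push₃ G G U S ν U₀) U₀ U₀ (Kggu * W) r) (hggg : BiLoc (c • push₃ G G G S ν U₀) U₀ U₀ (Kggg * W) r) :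
    BiLoc (c • push₃ (U + G) (U + G) (U + G) S ν U₀) U₀ U₀ ((Kuuu + Kuug + Kugu + Kugg + Kguu + Kgug + Kggu + Kggg) * W) r := by
  rw [push₃_add_legs_eq_sum_cells hU hG hUr hGr hS hδ ν U₀]
  simp only [smul_add]
  have e : (Kuuu + Kuug + Kugu + Kugg + Kguu + Kgug + Kggu + Kggg) * W
      = Kuuu * W + Kuug * W + Kugu * W + Kugg * W + Kguu * W + Kgug * W + Kggu * W + Kggg * W := by ring
  rw [e]
  exact biLoc_add (biLoc_add (biLoc_add (biLoc_add (biLoc_add (biLoc_add (biLoc_add huuu huug) hugu) hugg) hguu) hgug) hggu) hggg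

/-- NOT IN PRINT; OUR BOOKKEEPING.  **THE SAME FOR LEGS WITH A DISPLAYED SPLIT** `hT : T = U + G` (the consumer's form: `T = legChain (respStepBmSeq (toSite rr) Lc) (m+1) k`, the
split = the K-LL-4 decomposition of record). -/
theorem biLoc_smul_push₃_of_cells' {T : Fin (d + 1) → (Fin (d + 1) → ℤ) → Fin (d + 1) → (Fin (d + 1) → ℤ) → ℝ} (hT : T = U + G)
    (hU : ∀ α x' κ x, |U α x' κ x| ≤ CU) (hG : ∀ α x' κ x, |G α x' κ x| ≤ CG)
    (hUr : ∀ α x' κ, Summable fun x => U α x' κ x) (hGr : ∀ α x' κ, Summable fun x => G α x' κ x)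
    (hS : LocStencil S Cs δ) (hδ : 0 < δ) (c : ℝ) (ν : Fin (d + 1)) (U₀ : Fin (d + 1) → ℤ) {r W Kuuu Kuug Kugu Kugg Kguu Kgug Kggu Kggg : ℝ}
    (huuu : BiLoc (c • push₃ U U U S ν U₀) U₀ U₀ (Kuuu * W) r) (huug : BiLoc (c • push₃ U U G S ν U₀) U₀ U₀ (Kuug * W) r)
    (hugu : BiLoc (c • push₃ U G U S ν U₀) U₀ U₀ (Kugu * W) r) (hugg : BiLoc (c • push₃ U G G S ν U₀) U₀ U₀ (Kugg * W) r)
    (hguu : BiLoc (c • push₃ G U U S ν U₀) U₀ U₀ (Kguu * W) r) (hgug : BiLoc (c • push₃ G U G S ν U₀) U₀ U₀ (Kgug * W) r)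
    (hggu : BiLoc (c • push₃ G G U S ν U₀) U₀ U₀ (Kggu * W) r) (hggg : BiLoc (c • push₃ G G G S ν U₀) U₀ U₀ (Kggg * W) r) :
    BiLoc (c • push₃ T T T S ν U₀) U₀ U₀ ((Kuuu + Kuug + Kugu + Kugg + Kguu + Kgug + Kggu + Kggg) * W) r := by
  subst hT
  exact biLoc_smul_push₃_of_cells hU hG hUr hGr hS hδ c ν U₀ huuu huug hugu hugg hguu hgug hggu hggg


/-! ## §3 The telescope socket: the pure cell plus THREE one-gauge cells -/

/-- NOT IN PRINT; OUR BOOKKEEPING (`Push3LegTelescope.push₃_telescope` — this lineage's CT-3c one-leg-at-a-time telescoping, g58 — ⨾ `smul_add` ⨾ `KernelWard.biLoc_add`).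
**THE TELESCOPE SOCKET OF `hLT`** (the CT-3 route's form, `ContactKernelCells`: dressed = undressed + ONE pure-gauge leg at a time): if the pure cell `push₃ U U U S` and the three
ONE-GAUGE cells `push₃ (T−U) T T S`, `push₃ U (T−U) T S`, `push₃ U U (T−U) S` (gauge leg `T − U = dz λ` for the literal, `ContactKernelCells.legChain_respStepBmSeq_sub_respStep`;
the other legs dressed `T` resp. undressed `U` as displayed), weighted by the common scalar `c`, are bi-localised at `U₀` with rate `r` and constants `K₀·W, K₁·W, K₂·W, K₃·W`,
then so is the cubic push through the DRESSED legs `T`, with constant `(K₀ + K₁ + K₂ + K₃)·W` — three gauge cells instead of seven, at the price of dressed co-legs. -/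
theorem biLoc_smul_push₃_of_telescope {T : Fin (d + 1) → (Fin (d + 1) → ℤ) → Fin (d + 1) → (Fin (d + 1) → ℤ) → ℝ} {CT : ℝ}
    (hT : ∀ α x' κ x, |T α x' κ x| ≤ CT) (hU : ∀ α x' κ x, |U α x' κ x| ≤ CU)
    (hTr : ∀ α x' κ, Summable fun x => T α x' κ x) (hUr : ∀ α x' κ, Summable fun x => U α x' κ x)
    (hS : LocStencil S Cs δ) (hδ : 0 < δ) (c : ℝ) (ν : Fin (d + 1)) (U₀ : Fin (d + 1) → ℤ) {r W K₀ K₁ K₂ K₃ : ℝ}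
    (h₀ : BiLoc (c • push₃ U U U S ν U₀) U₀ U₀ (K₀ * W) r)
    (h₁ : BiLoc (c • push₃ (T - U) T T S ν U₀) U₀ U₀ (K₁ * W) r)
    (h₂ : BiLoc (c • push₃ U (T - U) T S ν U₀) U₀ U₀ (K₂ * W) r)
    (h₃ : BiLoc (c • push₃ U U (T - U) S ν U₀) U₀ U₀ (K₃ * W) r) :
    BiLoc (c • push₃ T T T S ν U₀) U₀ U₀ ((K₀ + K₁ + K₂ + K₃) * W) r := by
  have htel := push₃_telescope (lE := T) (lB := U) (rE := T) (rB := U) (wE := T) (wB := U) hT hTr hU hUr hTr hUr hT hU hS hδ ν U₀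
  have e : push₃ T T T S ν U₀ = push₃ U U U S ν U₀ + push₃ (T - U) T T S ν U₀ + push₃ U (T - U) T S ν U₀ + push₃ U U (T - U) S ν U₀ := by
    rw [sub_eq_iff_eq_add'.1 htel]
    abel
  rw [e]
  simp only [smul_add]
  have eK : (K₀ + K₁ + K₂ + K₃) * W = K₀ * W + K₁ * W + K₂ * W + K₃ * W := by ring
  rw [eK]
  exact biLoc_add (biLoc_add (biLoc_add h₀ h₁) h₂) h₃

end Summit.QuantumFields.BalabanUV.Beta.GAN24.LayerTransportCells

end
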